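import Literature.Analysis.FluidPDE.KNSSSwirlSupNonpos
import Literature.Analysis.FluidPDE.HessianLaplacian
import HarnessLib

/-!
# Lei–Ren–Zhang 2019, Theorem 1.2: the weighted energy identity for the swirl equation

Analysis/FluidPDE proof file (no named facts, no `sorry`) on the discharge path of the named fact
`Literature.Analysis.FluidPDE.leiRenZhang2019_liouville_swirl_rate` (Z. Lei, X. Ren, Q. S. Zhang,
*On ancient periodic solutions to axially-symmetric Navier–Stokes equations*, arXiv:1902.11229,
Theorem 1.2; proof in §4, pp. 10–12: "We will apply a weighted energy method for the function
`Γ = r v_θ`, exploiting the special structure of the equation and the fact that `Γ = 0` at the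
`z` axis").

The printed proof multiplies the swirl equation
`∂ₜΓ + b·∇Γ + (2/r)∂ᵣΓ = ΔΓ` (written in the half plane `(r, z)` as (4.2)) by `Γ φ² λ(r)` and
integrates by parts in `r`, `z`, `t` ((4.4)–(4.13)). This file proves that computation on
`ℝ³ × (a, b)` for a general smooth compactly supported axisymmetric weight `Ψ` and a `C¹` time
profile `ζ`, in the solution class in which the tree delivers the swirl equation for bounded
ancient solutions (KNSS 2009, (5.10), time-integrated off the axis:
`KNSS2009_regularity_axisymmetric_swirl`, proved in `KNSSThm53OfWindow`):

* `integral_laplacian_mul_self_mul`, `integral_fderiv_apply_mul_self_mul`,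
  `integral_two_div_cylRadius_mul_fderiv_eR_mul_self_mul`: the three spatial integrations by
  parts of `ΔΓ·ΓΨ`, `DΓ[b]·ΓΨ` and `(2/r)∂ᵣΓ·ΓΨ` (Green's identity, `div b = 0`, and the axis
  integration by parts of KNSS 2009, (5.19)–(5.20), `integral_two_div_cylRadius_mul_fderiv_eR`,
  applied to `Γ²`, which vanishes on the axis);
* `swirl_energy_slice_identity`: on one time slice,
  `∫ (ΔΓ − DΓ[b] − (2/r)∂ᵣΓ) Γ Ψ = −∫ |∇Γ|² Ψ + ½∫ (Γ² − c) ΔΨ + ½∫ (Γ² − c) DΨ[b] + ½∫ (2/r) Γ² ∂ᵣΨ`;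
* `swirl_energy_line_identity`: on a line `{y} × [a, b]` off the axis, from the time-integrated
  equation `Γ(t) − Γ(s) = ∫ₛᵗ g`, `∫ₐᵇ g Γ ζ = ½(Γ(b)²ζ(b) − Γ(a)²ζ(a)) − ½∫ₐᵇ Γ² ζ'`
  (absolute continuity of `Γ(·, y)` and `Γ(·, y)²`, Lebesgue's differentiation theorem);
* `swirl_energy_spaceTime_identity`: the weighted energy identity on `ℝ³ × (a, b)`,
  `∫∫ ζ |∇Γ|² Ψ = ½∫∫ ζ (Γ² − c)(ΔΨ + DΨ[b]) + ½∫∫ ζ (2/r) Γ² ∂ᵣΨ + ½∫∫ ζ' Γ² Ψ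
     − ½ ζ(b) ∫ Γ(b)² Ψ + ½ ζ(a) ∫ Γ(a)² Ψ`,
  all space–time integrands being integrable (Lei–Ren–Zhang 2019, (4.4) with (4.5)–(4.13), in
  Cartesian form: the printed measure `λ(r) dr dz` is the weight `Ψ = φ² λ(r)/r` against `dx`).

## References

* Z. Lei, X. Ren, Q. S. Zhang, arXiv:1902.11229, Theorem 1.2 (p. 4) and §4 (pp. 10–12).
  [LeiRenZhang2019]
* G. Koch, N. Nadirashvili, G. Seregin, V. Šverák, Acta Math. 203 (2009) = arXiv:0709.3599,
  proof of Theorem 5.3, (5.10), (5.15)–(5.20) (p. 10). [KochNadirashviliSereginSverak2009]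
-/

noncomputable section

open MeasureTheory Set Function Filter Topology TopologicalSpace InnerProductSpace WithLp Metric
open scoped Laplacian RealInnerProductSpace ContDiff

namespace Literature.Analysis.FluidPDE

/-! ### Calculus of `F²` -/

section Square

/-- `D(F²)(y)[v] = 2 F(y) DF(y)[v]`. [folklore] -/
theorem fderiv_mul_self_apply {F : (EuclideanSpace ℝ (Fin 3)) → ℝ} {y : (EuclideanSpace ℝ (Fin 3))} (hF : DifferentiableAt ℝ F y) (v : (EuclideanSpace ℝ (Fin 3))) :
    fderiv ℝ (fun z => F z * F z) y v = 2 * F y * fderiv ℝ F y v := by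
  have h : HasFDerivAt (fun z => F z * F z) (F y • fderiv ℝ F y + F y • fderiv ℝ F y) y :=
    hF.hasFDerivAt.mul hF.hasFDerivAt
  rw [h.fderiv]
  show F y * fderiv ℝ F y v + F y * fderiv ℝ F y v = 2 * F y * fderiv ℝ F y v
  ring

/-- `Δ(F²) = 2 F ΔF + 2 |∇F|²` for `F ∈ C²` (Leibniz rule for the Laplacian). [folklore] -/
theorem laplacian_mul_self {F : (EuclideanSpace ℝ (Fin 3)) → ℝ} (hF : ContDiff ℝ 2 F) (y : (EuclideanSpace ℝ (Fin 3))) :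
    (Δ fun z => F z * F z) y = 2 * F y * (Δ F) y + 2 * ∑ i, (fderiv ℝ F y ((EuclideanSpace.basisFun (Fin 3) ℝ) i)) ^ 2 := by
  rw [laplacian_mul_eq (EuclideanSpace.basisFun (Fin 3) ℝ) hF hF y]
  simp only [sq]
  ring

end Square

/-! ### The three spatial integrations by parts on a time slice -/

section SliceIBP

/-- **Green's identity for `ΔF · F Ψ`**: for `F ∈ C²` and `Ψ ∈ C²_c`, and any constant `c`,
`∫ ΔF F Ψ = ½ ∫ (F² − c) ΔΨ − ∫ |∇F|² Ψ` (from `∫ (F² − c) ΔΨ = ∫ Δ(F²) Ψ` and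
`Δ(F²) = 2FΔF + 2|∇F|²`; Lei–Ren–Zhang 2019, §4, the first integration by parts of (4.4)). [cite: LeiRenZhang2019, §4 (4.4) (arXiv p. 10)] -/
theorem integral_laplacian_mul_self_mul {F Ψ : (EuclideanSpace ℝ (Fin 3)) → ℝ} (hF : ContDiff ℝ 2 F) (hΨ : ContDiff ℝ 2 Ψ)
    (hΨc : HasCompactSupport Ψ) (c : ℝ) :
    ∫ y, (Δ F) y * (F y * Ψ y) =
      (1 / 2) * (∫ y, (F y * F y - c) * (Δ Ψ) y) - ∫ y, (∑ i, (fderiv ℝ F y ((EuclideanSpace.basisFun (Fin 3) ℝ) i)) ^ 2) * Ψ y := by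
  have hF2 : ContDiff ℝ 2 fun z => F z * F z := hF.mul hF
  have hgreen := integral_sub_const_mul_laplacian_eq hF2 hΨ hΨc c
  -- continuity and integrability of the pieces
  have hcΨ : Continuous Ψ := hΨ.continuous
  have hcΔF : Continuous (Δ F) := continuous_laplacian hF
  have hcF : Continuous F := hF.continuous
  have hcD : ∀ i, Continuous fun y => fderiv ℝ F y ((EuclideanSpace.basisFun (Fin 3) ℝ) i) := fun i =>
    (hF.continuous_fderiv (by norm_num)).clm_apply continuous_const
  have hcS : Continuous fun y => ∑ i, (fderiv ℝ F y ((EuclideanSpace.basisFun (Fin 3) ℝ) i)) ^ 2 :=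
    continuous_finsetSum _ fun i _ => (hcD i).pow 2
  have hi1 : Integrable fun y => (Δ F) y * (F y * Ψ y) :=
    (hcΔF.mul (hcF.mul hcΨ)).integrable_of_hasCompactSupport (hΨc.mul_left.mul_left)
  have hi2 : Integrable fun y => (∑ i, (fderiv ℝ F y ((EuclideanSpace.basisFun (Fin 3) ℝ) i)) ^ 2) * Ψ y :=
    (hcS.mul hcΨ).integrable_of_hasCompactSupport hΨc.mul_left
  have hsplit : ∫ y, (Δ fun z => F z * F z) y * Ψ y =
      2 * (∫ y, (Δ F) y * (F y * Ψ y)) + 2 * ∫ y, (∑ i, (fderiv ℝ F y ((EuclideanSpace.basisFun (Fin 3) ℝ) i)) ^ 2) * Ψ y := by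
    rw [← integral_const_mul, ← integral_const_mul, ← integral_add (hi1.const_mul 2) (hi2.const_mul 2)]
    refine integral_congr_ae (Eventually.of_forall fun y => ?_)
    simp only [laplacian_mul_self hF y]
    ring
  rw [hsplit] at hgreen
  linarith

/-- **The transport term against a divergence-free drift**: for `V ∈ C¹` with `div V = 0`,
`F ∈ C¹`, `Ψ ∈ C¹_c` and any constant `c`, `∫ DF[V] F Ψ = −½ ∫ (F² − c) DΨ[V]`
(Lei–Ren–Zhang 2019, §4, (4.5)/(4.9): "After integration by parts and using the divergence free
property of `v_r e_r + v_z e_z`"). [cite: LeiRenZhang2019, §4 (4.5) (arXiv p. 10)] -/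
theorem integral_fderiv_apply_mul_self_mul {F Ψ : (EuclideanSpace ℝ (Fin 3)) → ℝ} {V : (EuclideanSpace ℝ (Fin 3)) → (EuclideanSpace ℝ (Fin 3))} (hV : ContDiff ℝ 1 V)
    (hdiv : VectorCalculus.IsDivFree V) (hF : ContDiff ℝ 1 F) (hΨ : ContDiff ℝ 1 Ψ)
    (hΨc : HasCompactSupport Ψ) (c : ℝ) :
    ∫ y, fderiv ℝ F y (V y) * (F y * Ψ y) = -(1 / 2) * ∫ y, (F y * F y - c) * fderiv ℝ Ψ y (V y) := by
  have hF2 : ContDiff ℝ 1 fun z => F z * F z := hF.mul hF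
  have h := integral_sub_const_mul_fderiv_apply_eq hV hdiv hF2 hΨ hΨc c
  have hFd : ∀ y, DifferentiableAt ℝ F y := fun y => hF.differentiable one_ne_zero y
  have h2 : ∫ y, fderiv ℝ (fun z => F z * F z) y (V y) * Ψ y = 2 * ∫ y, fderiv ℝ F y (V y) * (F y * Ψ y) := by
    rw [← integral_const_mul]
    refine integral_congr_ae (Eventually.of_forall fun y => ?_)
    simp only [fderiv_mul_self_apply (hFd y)]
    ring
  rw [h2] at h
  linarith

/-- **The axis term**: for axisymmetric `C¹` scalars `F`, `Ψ` with `Ψ` compactly supported and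
`F = 0` on the axis, `∫ (2/r) ∂ᵣF F Ψ = −½ ∫ (2/r) F² ∂ᵣΨ`, both integrands being integrable
(the axis integration by parts of KNSS 2009, (5.19)–(5.20), applied to `F²`; Lei–Ren–Zhang 2019,
§4, the terms `T₁₄, T₁₅` of (4.5): the `(1/r)∂ᵣΓ²` term integrated in `r` using `Γ = 0` on the
axis). [cite: LeiRenZhang2019, §4 (4.5) (arXiv pp. 10–11); KochNadirashviliSereginSverak2009, (5.19)–(5.20)] -/
theorem integral_two_div_cylRadius_mul_fderiv_eR_mul_self_mul {F Ψ : (EuclideanSpace ℝ (Fin 3)) → ℝ} (hF : ContDiff ℝ 1 F)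
    (hΨ : ContDiff ℝ 1 Ψ) (hΨc : HasCompactSupport Ψ) (hFa : IsAxisymmetricScalar F)
    (hΨa : IsAxisymmetricScalar Ψ) (hF0 : ∀ x, cylRadius x = 0 → F x = 0) :
    Integrable (fun y => 2 / cylRadius y * (fderiv ℝ F y (eR y) * (F y * Ψ y))) ∧
    Integrable (fun y => 2 / cylRadius y * (F y * F y * fderiv ℝ Ψ y (eR y))) ∧
    ∫ y, 2 / cylRadius y * (fderiv ℝ F y (eR y) * (F y * Ψ y)) =
      -(1 / 2) * ∫ y, 2 / cylRadius y * (F y * F y * fderiv ℝ Ψ y (eR y)) := by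
  have hF2 : ContDiff ℝ 1 fun z => F z * F z := hF.mul hF
  have hF2a : IsAxisymmetricScalar fun z => F z * F z := fun θ x => by simp only [hFa θ x]
  have hF20 : ∀ x, cylRadius x = 0 → F x * F x = 0 := fun x hx => by rw [hF0 x hx, mul_zero]
  obtain ⟨hi1, hi2, h⟩ := integrable_and_integral_two_div_cylRadius_mul_fderiv_eR hF2 hΨ hΨc hF2a hΨa hF20
  have hFd : ∀ y, DifferentiableAt ℝ F y := fun y => hF.differentiable one_ne_zero y
  have hptw : ∀ y, 2 / cylRadius y * (fderiv ℝ (fun z => F z * F z) y (eR y) * Ψ y) =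
      2 * (2 / cylRadius y * (fderiv ℝ F y (eR y) * (F y * Ψ y))) := fun y => by
    rw [fderiv_mul_self_apply (hFd y)]
    ring
  have hi1' : Integrable fun y => 2 / cylRadius y * (fderiv ℝ F y (eR y) * (F y * Ψ y)) := by
    have := hi1.const_mul (1 / 2)
    refine this.congr (Eventually.of_forall fun y => ?_)
    simp only [hptw y]
    ring
  refine ⟨hi1', hi2, ?_⟩
  have h2 : ∫ y, 2 / cylRadius y * (fderiv ℝ (fun z => F z * F z) y (eR y) * Ψ y) =
      2 * ∫ y, 2 / cylRadius y * (fderiv ℝ F y (eR y) * (F y * Ψ y)) := by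
    rw [← integral_const_mul]
    exact integral_congr_ae (Eventually.of_forall hptw)
  rw [h2] at h
  linarith

/-- **The weighted energy identity on a time slice** (Lei–Ren–Zhang 2019, §4, (4.4)–(4.5) on one
slice, Cartesian form). For `F ∈ C²` axisymmetric with `F = 0` on the axis, a divergence-free
drift `V ∈ C¹`, a weight `Ψ ∈ C²_c` axisymmetric and a constant `c`:
`∫ (ΔF − DF[V] − (2/r)∂ᵣF) F Ψ = −∫ |∇F|² Ψ + ½∫ (F² − c) ΔΨ + ½∫ (F² − c) DΨ[V] + ½∫ (2/r) F² ∂ᵣΨ`.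
[cite: LeiRenZhang2019, §4 (4.4)–(4.5) (arXiv p. 10)] -/
theorem swirl_energy_slice_identity {F Ψ : (EuclideanSpace ℝ (Fin 3)) → ℝ} {V : (EuclideanSpace ℝ (Fin 3)) → (EuclideanSpace ℝ (Fin 3))} (hF : ContDiff ℝ 2 F)
    (hFa : IsAxisymmetricScalar F) (hF0 : ∀ x, cylRadius x = 0 → F x = 0)
    (hV : ContDiff ℝ 1 V) (hdiv : VectorCalculus.IsDivFree V)
    (hΨ : ContDiff ℝ 2 Ψ) (hΨc : HasCompactSupport Ψ) (hΨa : IsAxisymmetricScalar Ψ) (c : ℝ) :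
    ∫ y, ((Δ F) y - fderiv ℝ F y (V y) - 2 / cylRadius y * partialDeriv (eR y) F y) * (F y * Ψ y) =
      -(∫ y, (∑ i, (fderiv ℝ F y ((EuclideanSpace.basisFun (Fin 3) ℝ) i)) ^ 2) * Ψ y)
      + (1 / 2) * (∫ y, (F y * F y - c) * (Δ Ψ) y)
      + (1 / 2) * (∫ y, (F y * F y - c) * fderiv ℝ Ψ y (V y))
      + (1 / 2) * ∫ y, 2 / cylRadius y * (F y * F y * fderiv ℝ Ψ y (eR y)) := by
  have hF1 : ContDiff ℝ 1 F := hF.of_le (by norm_num)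
  have hΨ1 : ContDiff ℝ 1 Ψ := hΨ.of_le (by norm_num)
  have hcΨ : Continuous Ψ := hΨ.continuous
  have hcF : Continuous F := hF.continuous
  have hcΔF : Continuous (Δ F) := continuous_laplacian hF
  have hcDFV : Continuous fun y => fderiv ℝ F y (V y) :=
    (hF.continuous_fderiv (by norm_num)).clm_apply hV.continuous
  have hi1 : Integrable fun y => (Δ F) y * (F y * Ψ y) :=
    (hcΔF.mul (hcF.mul hcΨ)).integrable_of_hasCompactSupport (hΨc.mul_left.mul_left)
  have hi2 : Integrable fun y => fderiv ℝ F y (V y) * (F y * Ψ y) :=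
    (hcDFV.mul (hcF.mul hcΨ)).integrable_of_hasCompactSupport (hΨc.mul_left.mul_left)
  obtain ⟨hi3, -, haxis⟩ := integral_two_div_cylRadius_mul_fderiv_eR_mul_self_mul hF1 hΨ1 hΨc hFa hΨa hF0
  have hgreen := integral_laplacian_mul_self_mul hF hΨ hΨc c
  have hconv := integral_fderiv_apply_mul_self_mul hV hdiv hF1 hΨ1 hΨc c
  have hsplit : ∫ y, ((Δ F) y - fderiv ℝ F y (V y) - 2 / cylRadius y * partialDeriv (eR y) F y) * (F y * Ψ y) =
      (∫ y, (Δ F) y * (F y * Ψ y)) - (∫ y, fderiv ℝ F y (V y) * (F y * Ψ y)) -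
        ∫ y, 2 / cylRadius y * (fderiv ℝ F y (eR y) * (F y * Ψ y)) := by
    have hi12 : Integrable fun y => (Δ F) y * (F y * Ψ y) - fderiv ℝ F y (V y) * (F y * Ψ y) :=
      hi1.sub hi2
    rw [← integral_sub hi1 hi2, ← integral_sub hi12 hi3]
    refine integral_congr_ae (Eventually.of_forall fun y => ?_)
    simp only [partialDeriv_apply]
    ring
  rw [hsplit, hgreen, hconv, haxis]
  ring

end SliceIBP

/-! ### Time integration by parts for the square of a function given by an integral -/

section TimeIBP

/-- **Time integration by parts for the energy.** If on `[a, b]` `Φ(s) = Φ(a) + ∫ₐˢ g` with `g`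
integrable and `ζ ∈ C¹`, then `∫ₐᵇ g Φ ζ = ½ (Φ(b)² ζ(b) − Φ(a)² ζ(a)) − ½ ∫ₐᵇ Φ² ζ'`
(the time integration by parts `∫ ∂ₜ(Γ²) φ² = [Γ² φ²] − ∫ Γ² ∂ₜφ²` of Lei–Ren–Zhang 2019, §4,
the terms `T₁₆, T₁₇` of (4.5), for the time-integrated swirl equation: `Φ` and `Φ²` are
absolutely continuous with `(Φ²)' = 2Φg` a.e. by Lebesgue's differentiation theorem). [cite: LeiRenZhang2019, §4 (4.5) (arXiv pp. 10–11)] -/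
theorem integral_mul_mul_eq_of_eq_add_integral {Φ g ζ : ℝ → ℝ} {a b : ℝ} (hab : a ≤ b)
    (hg : IntervalIntegrable g volume a b) (hΦ : ∀ s ∈ Icc a b, Φ s = Φ a + ∫ r in a..s, g r)
    (hζ : ContDiff ℝ 1 ζ) :
    ∫ s in a..b, g s * (Φ s * ζ s) =
      (1 / 2) * (Φ b * Φ b * ζ b - Φ a * Φ a * ζ a) - (1 / 2) * ∫ s in a..b, Φ s * Φ s * deriv ζ s := by
  have huab : uIcc a b = Icc a b := uIcc_of_le hab
  -- the absolutely continuous representative `P = Φ a + ∫ₐ g` of `Φ`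
  set P : ℝ → ℝ := fun s => Φ a + ∫ r in a..s, g r with hP
  have hPint : AbsolutelyContinuousOnInterval (fun s => ∫ r in a..s, g r) a b :=
    hg.absolutelyContinuousOnInterval_intervalIntegral (by simp [hab])
  have hPac : AbsolutelyContinuousOnInterval P a b := by
    have hc : AbsolutelyContinuousOnInterval (fun _ : ℝ => Φ a) a b :=
      (contDiff_const (c := Φ a)).contDiffOn.absolutelyContinuousOnInterval
    exact hc.add hPint
  have hP2ac : AbsolutelyContinuousOnInterval (fun s => P s * P s) a b := hPac.mul hPac
  have hζac : AbsolutelyContinuousOnInterval ζ a b := hζ.contDiffOn.absolutelyContinuousOnInterval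
  have hPΦ : ∀ s ∈ Icc a b, P s = Φ s := fun s hs => by rw [hP, hΦ s hs]
  have hζd : ∀ s, HasDerivAt ζ (deriv ζ s) s := fun s => ((hζ.differentiable one_ne_zero) s).hasDerivAt
  -- `(P²)' = 2 P g` a.e. on `[a, b]`
  have hderiv : ∀ᵐ s, s ∈ uIoc a b → deriv (fun s => P s * P s) s = 2 * P s * g s := by
    filter_upwards [hg.ae_hasDerivAt_integral] with s hs hsmem
    have hs' : s ∈ uIcc a b := uIoc_subset_uIcc hsmem
    have h1 : HasDerivAt (fun s => ∫ r in a..s, g r) (g s) s := hs hs' a (by simp)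
    have h2 : HasDerivAt P (g s) s := by
      simpa [hP] using h1.const_add (Φ a)
    have h3 : HasDerivAt (fun s => P s * P s) (g s * P s + P s * g s) s := h2.mul h2
    rw [h3.deriv]
    ring
  -- integration by parts for `P²` against `ζ`
  have hibp := hP2ac.integral_mul_deriv_eq_deriv_mul hζac
  have hrhs : ∫ s in a..b, deriv (fun s => P s * P s) s * ζ s = 2 * ∫ s in a..b, g s * (Φ s * ζ s) := by
    rw [← intervalIntegral.integral_const_mul]
    refine intervalIntegral.integral_congr_ae ?_
    filter_upwards [hderiv] with s hs hsmem
    have hs' : s ∈ Icc a b := by rw [← huab]; exact uIoc_subset_uIcc hsmem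
    rw [hs hsmem, hPΦ s hs']
    ring
  have hlhs : ∫ s in a..b, P s * P s * deriv ζ s = ∫ s in a..b, Φ s * Φ s * deriv ζ s := by
    refine intervalIntegral.integral_congr fun s hs => ?_
    rw [huab] at hs
    simp only [hPΦ s hs]
  have hPa : P a = Φ a := hPΦ a (left_mem_Icc.2 hab)
  have hPb : P b = Φ b := hPΦ b (right_mem_Icc.2 hab)
  rw [hrhs, hlhs, hPa, hPb] at hibp
  linarith

end TimeIBP

/-! ### The weighted energy identity on `ℝ³ × (a, b)`: integrability -/

section SpaceTime

variable {f : ℝ → (EuclideanSpace ℝ (Fin 3)) → ℝ} {b : ℝ → (EuclideanSpace ℝ (Fin 3)) → (EuclideanSpace ℝ (Fin 3))} {Ψ : (EuclideanSpace ℝ (Fin 3)) → ℝ} {ζ : ℝ → ℝ} {a b' Cb : ℝ}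

/-- The space–time measure `dt|_{(a, b']} ⊗ dx` is the restriction of `dt ⊗ dx` to the slab; a
function continuous on `(−∞, 0) × ℝ³` is a.e. strongly measurable for it when `b' < 0`.
[folklore] -/
theorem aestronglyMeasurable_slab_of_continuousOn {X : Type*} [TopologicalSpace X]
    [TopologicalSpace.PseudoMetrizableSpace X] [MeasurableSpace X] [BorelSpace X]
    (hb' : b' < 0) {g : ℝ × (EuclideanSpace ℝ (Fin 3)) → X} (hg : ContinuousOn g (Iio 0 ×ˢ univ)) :
    AEStronglyMeasurable g ((volume.restrict (Ioc a b')).prod (volume : Measure (EuclideanSpace ℝ (Fin 3)))) := by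
  rw [Measure.restrict_prod_eq_prod_univ]
  have hsub : Ioc a b' ×ˢ (univ : Set (EuclideanSpace ℝ (Fin 3))) ⊆ Iio 0 ×ˢ univ :=
    fun p hp => ⟨lt_of_le_of_lt hp.1.2 hb', mem_univ _⟩
  exact (hg.mono hsub).aestronglyMeasurable (measurableSet_Ioc.prod MeasurableSet.univ)

/-- Almost every point of the slab has its time in `(a, b']` and lies off the axis. [folklore] -/
theorem ae_slab_mem_and_cylRadius_ne_zero (a b' : ℝ) :
    ∀ᵐ p ∂((volume.restrict (Ioc a b')).prod (volume : Measure (EuclideanSpace ℝ (Fin 3)))), p.1 ∈ Ioc a b' ∧ cylRadius p.2 ≠ 0 := by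
  have h1 : ∀ᵐ p ∂((volume.restrict (Ioc a b')).prod (volume : Measure (EuclideanSpace ℝ (Fin 3)))),
      p ∈ Ioc a b' ×ˢ (univ : Set (EuclideanSpace ℝ (Fin 3))) := by
    rw [Measure.restrict_prod_eq_prod_univ]
    exact ae_restrict_mem (measurableSet_Ioc.prod MeasurableSet.univ)
  have h2 : ∀ᵐ p ∂((volume.restrict (Ioc a b')).prod (volume : Measure (EuclideanSpace ℝ (Fin 3)))), cylRadius p.2 ≠ 0 :=
    (Measure.quasiMeasurePreserving_snd (μ := volume.restrict (Ioc a b'))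
      (ν := (volume : Measure (EuclideanSpace ℝ (Fin 3))))).ae ae_cylRadius_ne_zero
  filter_upwards [h1, h2] with p hp1 hp2
  exact ⟨hp1.1, hp2⟩

/-- **Domination on the slab.** A measurable function on `(a, b'] × ℝ³` which vanishes when the
space point is outside the compact `tsupport Ψ` and is bounded there by `C (r⁻¹ + 1)` is
integrable (`1/r` is locally integrable, `integrableOn_inv_cylRadius_solidCylinder`). [folklore] -/
theorem integrable_slab_of_bound (hΨc : HasCompactSupport Ψ) {F : ℝ × (EuclideanSpace ℝ (Fin 3)) → ℝ}
    (hFm : AEStronglyMeasurable F ((volume.restrict (Ioc a b')).prod (volume : Measure (EuclideanSpace ℝ (Fin 3)))))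
    {C : ℝ} (hC : 0 ≤ C)
    (hin : ∀ᵐ p ∂((volume.restrict (Ioc a b')).prod (volume : Measure (EuclideanSpace ℝ (Fin 3)))),
      p.2 ∈ tsupport Ψ → |F p| ≤ C * ((cylRadius p.2)⁻¹ + 1))
    (hout : ∀ p : ℝ × (EuclideanSpace ℝ (Fin 3)), p.2 ∉ tsupport Ψ → F p = 0) :
    Integrable F ((volume.restrict (Ioc a b')).prod (volume : Measure (EuclideanSpace ℝ (Fin 3)))) := by
  obtain ⟨R, hR⟩ : ∃ R : ℝ, tsupport Ψ ⊆ closedBall (0 : (EuclideanSpace ℝ (Fin 3))) R :=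
    (hΨc.isCompact.isBounded).subset_closedBall 0
  have hK : tsupport Ψ ⊆ solidCylinder R R := hR.trans (closedBall_subset_solidCylinder R)
  set D : ℝ × (EuclideanSpace ℝ (Fin 3)) → ℝ := fun p => C * (solidCylinder R R).indicator (fun y => (cylRadius y)⁻¹ + 1) p.2
    with hD
  have hDint : Integrable D ((volume.restrict (Ioc a b')).prod (volume : Measure (EuclideanSpace ℝ (Fin 3)))) := by
    have hg : Integrable (fun y : (EuclideanSpace ℝ (Fin 3)) => (solidCylinder R R).indicator (fun y => (cylRadius y)⁻¹ + 1) y) :=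
      ((integrableOn_inv_cylRadius_solidCylinder R R).add (integrableOn_const (C := (1 : ℝ))
        (volume_solidCylinder_lt_top R R).ne)).integrable_indicator (measurableSet_solidCylinder R R)
    have hf' : Integrable (fun _ : ℝ => C) (volume.restrict (Ioc a b')) :=
      integrableOn_const (C := C) measure_Ioc_lt_top.ne
    exact hf'.mul_prod hg
  refine hDint.mono' hFm (hin.mono fun p hp => ?_)
  rw [Real.norm_eq_abs]
  by_cases hy : p.2 ∈ tsupport Ψ
  · simp only [hD, indicator_of_mem (hK hy)]
    exact hp hy
  · rw [hout p hy, abs_zero]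
    simp only [hD]
    exact mul_nonneg hC (indicator_nonneg (fun y _ => add_nonneg (inv_nonneg.2 (cylRadius_nonneg y)) zero_le_one) _)

/-- Uniform bounds for `f`, `∇f`, `Δf` on the compact `[a, b'] × tsupport Ψ` (joint continuity).
[folklore] -/
theorem exists_bound_slab (hb' : b' < 0)
    (hfc : ContinuousOn (uncurry f) (Iio 0 ×ˢ univ))
    (hfD : ContinuousOn (fun p : ℝ × (EuclideanSpace ℝ (Fin 3)) => fderiv ℝ (f p.1) p.2) (Iio 0 ×ˢ univ))
    (hfΔ : ContinuousOn (fun p : ℝ × (EuclideanSpace ℝ (Fin 3)) => (Δ (f p.1)) p.2) (Iio 0 ×ˢ univ))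
    (hΨc : HasCompactSupport Ψ) :
    ∃ K : ℝ, 0 ≤ K ∧ ∀ s ∈ Icc a b', ∀ y ∈ tsupport Ψ,
      |f s y| ≤ K ∧ ‖fderiv ℝ (f s) y‖ ≤ K ∧ |(Δ (f s)) y| ≤ K := by
  have hKset : IsCompact (Icc a b' ×ˢ tsupport Ψ) := isCompact_Icc.prod hΨc.isCompact
  have hKsub : Icc a b' ×ˢ tsupport Ψ ⊆ Iio 0 ×ˢ univ :=
    fun p hp => ⟨lt_of_le_of_lt hp.1.2 hb', mem_univ _⟩
  obtain ⟨K₀, hK₀⟩ := hKset.exists_bound_of_continuousOn (hfc.mono hKsub)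
  obtain ⟨K₁, hK₁⟩ := hKset.exists_bound_of_continuousOn (hfD.mono hKsub)
  obtain ⟨K₂, hK₂⟩ := hKset.exists_bound_of_continuousOn (hfΔ.mono hKsub)
  refine ⟨max (max K₀ (max K₁ K₂)) 0, le_max_right _ _, fun s hs y hy => ⟨?_, ?_, ?_⟩⟩
  · have h := hK₀ (s, y) ⟨hs, hy⟩
    simp only [uncurry_apply_pair, Real.norm_eq_abs] at h
    exact h.trans ((le_max_left _ _).trans (le_max_left _ _))
  · exact (hK₁ (s, y) ⟨hs, hy⟩).trans ((le_max_left _ _).trans ((le_max_right _ _).trans (le_max_left _ _)))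
  · have h := hK₂ (s, y) ⟨hs, hy⟩
    rw [Real.norm_eq_abs] at h
    exact h.trans ((le_max_right _ _).trans ((le_max_right _ _).trans (le_max_left _ _)))

/-- Uniform bounds for a compactly supported `C²` weight, its gradient and its Laplacian.
[folklore] -/
theorem exists_bound_weight (hΨ : ContDiff ℝ 2 Ψ) (hΨc : HasCompactSupport Ψ) :
    ∃ B : ℝ, 0 ≤ B ∧ ∀ y, |Ψ y| ≤ B ∧ ‖fderiv ℝ Ψ y‖ ≤ B ∧ |(Δ Ψ) y| ≤ B := by
  obtain ⟨B₀, hB₀⟩ := hΨ.continuous.bounded_above_of_compact_support hΨc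
  obtain ⟨B₁, hB₁⟩ := (hΨ.continuous_fderiv (by norm_num)).bounded_above_of_compact_support
    (hΨc.fderiv (𝕜 := ℝ))
  obtain ⟨B₂, hB₂⟩ := (continuous_laplacian hΨ).bounded_above_of_compact_support
    (HasCompactSupport.laplacian_fun hΨc)
  refine ⟨max (max B₀ (max B₁ B₂)) 0, le_max_right _ _, fun y => ⟨?_, ?_, ?_⟩⟩
  · have h := hB₀ y; rw [Real.norm_eq_abs] at h
    exact h.trans ((le_max_left _ _).trans (le_max_left _ _))
  · exact (hB₁ y).trans ((le_max_left _ _).trans ((le_max_right _ _).trans (le_max_left _ _)))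
  · have h := hB₂ y; rw [Real.norm_eq_abs] at h
    exact h.trans ((le_max_right _ _).trans ((le_max_right _ _).trans (le_max_left _ _)))

/-- Uniform bounds for a `C¹` time profile and its derivative on `[a, b']`. [folklore] -/
theorem exists_bound_profile (hζ : ContDiff ℝ 1 ζ) (a b' : ℝ) :
    ∃ Z : ℝ, 0 ≤ Z ∧ ∀ s ∈ Icc a b', |ζ s| ≤ Z ∧ |deriv ζ s| ≤ Z := by
  obtain ⟨Z₀, hZ₀⟩ := (isCompact_Icc (a := a) (b := b')).exists_bound_of_continuousOn hζ.continuous.continuousOn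
  obtain ⟨Z₁, hZ₁⟩ := (isCompact_Icc (a := a) (b := b')).exists_bound_of_continuousOn
    (hζ.continuous_deriv le_rfl).continuousOn
  refine ⟨max (max Z₀ Z₁) 0, le_max_right _ _, fun s hs => ⟨?_, ?_⟩⟩
  · have h := hZ₀ s hs; rw [Real.norm_eq_abs] at h
    exact h.trans ((le_max_left _ _).trans (le_max_left _ _))
  · have h := hZ₁ s hs; rw [Real.norm_eq_abs] at h
    exact h.trans ((le_max_right _ _).trans (le_max_left _ _))

/-- Off the support of the weight, the weight, its gradient and its Laplacian vanish. [folklore] -/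
theorem weight_derivs_eq_zero_of_notMem {y : (EuclideanSpace ℝ (Fin 3))} (hy : y ∉ tsupport Ψ) :
    Ψ y = 0 ∧ fderiv ℝ Ψ y = 0 ∧ (Δ Ψ) y = 0 :=
  ⟨image_eq_zero_of_notMem_tsupport hy, fderiv_of_notMem_tsupport ℝ hy, laplacian_eq_zero_of_notMem_tsupport hy⟩

/-- Integrability on the slab of the dissipation integrand `ζ |∇f|² Ψ`. [folklore] -/
theorem integrable_slab_dissipation (hb' : b' < 0)
    (hfc : ContinuousOn (uncurry f) (Iio 0 ×ˢ univ))
    (hfD : ContinuousOn (fun p : ℝ × (EuclideanSpace ℝ (Fin 3)) => fderiv ℝ (f p.1) p.2) (Iio 0 ×ˢ univ))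
    (hfΔ : ContinuousOn (fun p : ℝ × (EuclideanSpace ℝ (Fin 3)) => (Δ (f p.1)) p.2) (Iio 0 ×ˢ univ))
    (hΨ : ContDiff ℝ 2 Ψ) (hΨc : HasCompactSupport Ψ) (hζ : ContDiff ℝ 1 ζ) :
    Integrable (fun p : ℝ × (EuclideanSpace ℝ (Fin 3)) => ζ p.1 * ((∑ i, (fderiv ℝ (f p.1) p.2 ((EuclideanSpace.basisFun (Fin 3) ℝ) i)) ^ 2) * Ψ p.2))
      ((volume.restrict (Ioc a b')).prod (volume : Measure (EuclideanSpace ℝ (Fin 3)))) := by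
  obtain ⟨K, hK0, hK⟩ := exists_bound_slab hb' hfc hfD hfΔ hΨc
  obtain ⟨B, hB0, hB⟩ := exists_bound_weight hΨ hΨc
  obtain ⟨Z, hZ0, hZ⟩ := exists_bound_profile hζ a b'
  have happly : Continuous fun q : ((EuclideanSpace ℝ (Fin 3)) →L[ℝ] ℝ) × (EuclideanSpace ℝ (Fin 3)) => q.1 q.2 :=
    (isBoundedBilinearMap_apply (𝕜 := ℝ) (E := (EuclideanSpace ℝ (Fin 3))) (F := ℝ)).continuous
  have hm : AEStronglyMeasurable (fun p : ℝ × (EuclideanSpace ℝ (Fin 3)) => ζ p.1 * ((∑ i, (fderiv ℝ (f p.1) p.2 ((EuclideanSpace.basisFun (Fin 3) ℝ) i)) ^ 2) * Ψ p.2))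
      ((volume.restrict (Ioc a b')).prod (volume : Measure (EuclideanSpace ℝ (Fin 3)))) := by
    refine (hζ.continuous.comp continuous_fst).aestronglyMeasurable.mul
      (AEStronglyMeasurable.mul ?_ (hΨ.continuous.comp continuous_snd).aestronglyMeasurable)
    refine Finset.aestronglyMeasurable_fun_sum _ fun i _ => ?_
    have h1 := aestronglyMeasurable_slab_of_continuousOn (a := a) hb' hfD
    exact (happly.comp_aestronglyMeasurable (h1.prodMk aestronglyMeasurable_const)).pow 2
  refine integrable_slab_of_bound hΨc hm (C := Z * (3 * K ^ 2) * B) (by positivity)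
    ((ae_slab_mem_and_cylRadius_ne_zero a b').mono fun p hp hy => ?_)
    (fun p hy => by rw [(weight_derivs_eq_zero_of_notMem hy).1]; ring)
  have hs : p.1 ∈ Icc a b' := Ioc_subset_Icc_self hp.1
  have h1 : ∀ i, (fderiv ℝ (f p.1) p.2 ((EuclideanSpace.basisFun (Fin 3) ℝ) i)) ^ 2 ≤ K ^ 2 := fun i => by
    have h : |fderiv ℝ (f p.1) p.2 ((EuclideanSpace.basisFun (Fin 3) ℝ) i)| ≤ K := by
      rw [← Real.norm_eq_abs]
      refine ((fderiv ℝ (f p.1) p.2).le_opNorm _).trans ?_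
      rw [EuclideanSpace.basisFun_apply, PiLp.norm_single, norm_one, mul_one]
      exact (hK p.1 hs p.2 hy).2.1
    rw [abs_le] at h
    nlinarith
  have h2 : |∑ i, (fderiv ℝ (f p.1) p.2 ((EuclideanSpace.basisFun (Fin 3) ℝ) i)) ^ 2| ≤ 3 * K ^ 2 := by
    rw [abs_of_nonneg (Finset.sum_nonneg fun i _ => sq_nonneg _)]
    calc ∑ i, (fderiv ℝ (f p.1) p.2 ((EuclideanSpace.basisFun (Fin 3) ℝ) i)) ^ 2 ≤ ∑ _i : Fin 3, K ^ 2 := Finset.sum_le_sum fun i _ => h1 i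
      _ = 3 * K ^ 2 := by simp
  rw [abs_mul, abs_mul]
  have hri : 0 ≤ (cylRadius p.2)⁻¹ := inv_nonneg.2 (cylRadius_nonneg _)
  calc |ζ p.1| * (|∑ i, (fderiv ℝ (f p.1) p.2 ((EuclideanSpace.basisFun (Fin 3) ℝ) i)) ^ 2| * |Ψ p.2|) ≤ Z * (3 * K ^ 2 * B) :=
        mul_le_mul (hZ p.1 hs).1 (mul_le_mul h2 (hB p.2).1 (abs_nonneg _) (by positivity)) (by positivity) hZ0
    _ ≤ Z * (3 * K ^ 2) * B * ((cylRadius p.2)⁻¹ + 1) := by nlinarith [mul_nonneg (by positivity : (0:ℝ) ≤ Z * (3 * K ^ 2) * B) hri]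

/-- Integrability on the slab of `ζ (f² − c) ΔΨ`. [folklore] -/
theorem integrable_slab_laplacian (hb' : b' < 0)
    (hfc : ContinuousOn (uncurry f) (Iio 0 ×ˢ univ))
    (hfD : ContinuousOn (fun p : ℝ × (EuclideanSpace ℝ (Fin 3)) => fderiv ℝ (f p.1) p.2) (Iio 0 ×ˢ univ))
    (hfΔ : ContinuousOn (fun p : ℝ × (EuclideanSpace ℝ (Fin 3)) => (Δ (f p.1)) p.2) (Iio 0 ×ˢ univ))
    (hΨ : ContDiff ℝ 2 Ψ) (hΨc : HasCompactSupport Ψ) (hζ : ContDiff ℝ 1 ζ) (c : ℝ) :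
    Integrable (fun p : ℝ × (EuclideanSpace ℝ (Fin 3)) => ζ p.1 * ((f p.1 p.2 * f p.1 p.2 - c) * (Δ Ψ) p.2))
      ((volume.restrict (Ioc a b')).prod (volume : Measure (EuclideanSpace ℝ (Fin 3)))) := by
  obtain ⟨K, hK0, hK⟩ := exists_bound_slab hb' hfc hfD hfΔ hΨc
  obtain ⟨B, hB0, hB⟩ := exists_bound_weight hΨ hΨc
  obtain ⟨Z, hZ0, hZ⟩ := exists_bound_profile hζ a b'
  have hfm := aestronglyMeasurable_slab_of_continuousOn (a := a) hb' hfc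
  have hm : AEStronglyMeasurable (fun p : ℝ × (EuclideanSpace ℝ (Fin 3)) => ζ p.1 * ((f p.1 p.2 * f p.1 p.2 - c) * (Δ Ψ) p.2))
      ((volume.restrict (Ioc a b')).prod (volume : Measure (EuclideanSpace ℝ (Fin 3)))) :=
    (hζ.continuous.comp continuous_fst).aestronglyMeasurable.mul
      (((hfm.mul hfm).sub aestronglyMeasurable_const).mul
        ((continuous_laplacian hΨ).comp continuous_snd).aestronglyMeasurable)
  refine integrable_slab_of_bound hΨc hm (C := Z * (K * K + |c|) * B) (by positivity)
    ((ae_slab_mem_and_cylRadius_ne_zero a b').mono fun p hp hy => ?_)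
    (fun p hy => by rw [(weight_derivs_eq_zero_of_notMem hy).2.2]; ring)
  have hs : p.1 ∈ Icc a b' := Ioc_subset_Icc_self hp.1
  have hf1 := (hK p.1 hs p.2 hy).1
  have hf2 : |f p.1 p.2 * f p.1 p.2 - c| ≤ K * K + |c| :=
    (abs_sub _ _).trans (add_le_add (by rw [abs_mul]; exact mul_le_mul hf1 hf1 (abs_nonneg _) hK0) le_rfl)
  rw [abs_mul, abs_mul]
  have hri : 0 ≤ (cylRadius p.2)⁻¹ := inv_nonneg.2 (cylRadius_nonneg _)
  calc |ζ p.1| * (|f p.1 p.2 * f p.1 p.2 - c| * |(Δ Ψ) p.2|) ≤ Z * ((K * K + |c|) * B) :=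
        mul_le_mul (hZ p.1 hs).1 (mul_le_mul hf2 (hB p.2).2.2 (abs_nonneg _) (by positivity)) (by positivity) hZ0
    _ ≤ Z * (K * K + |c|) * B * ((cylRadius p.2)⁻¹ + 1) := by nlinarith [mul_nonneg (by positivity : (0:ℝ) ≤ Z * (K * K + |c|) * B) hri]

/-- Integrability on the slab of the transport integrand `ζ (f² − c) DΨ[b]`. [folklore] -/
theorem integrable_slab_transport (hb' : b' < 0)
    (hfc : ContinuousOn (uncurry f) (Iio 0 ×ˢ univ))
    (hfD : ContinuousOn (fun p : ℝ × (EuclideanSpace ℝ (Fin 3)) => fderiv ℝ (f p.1) p.2) (Iio 0 ×ˢ univ))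
    (hfΔ : ContinuousOn (fun p : ℝ × (EuclideanSpace ℝ (Fin 3)) => (Δ (f p.1)) p.2) (Iio 0 ×ˢ univ))
    (hbm : Measurable (uncurry b)) (hbB : ∀ t < 0, ∀ x, ‖b t x‖ ≤ Cb)
    (hΨ : ContDiff ℝ 2 Ψ) (hΨc : HasCompactSupport Ψ) (hζ : ContDiff ℝ 1 ζ) (c : ℝ) :
    Integrable (fun p : ℝ × (EuclideanSpace ℝ (Fin 3)) => ζ p.1 * ((f p.1 p.2 * f p.1 p.2 - c) * fderiv ℝ Ψ p.2 (b p.1 p.2)))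
      ((volume.restrict (Ioc a b')).prod (volume : Measure (EuclideanSpace ℝ (Fin 3)))) := by
  obtain ⟨K, hK0, hK⟩ := exists_bound_slab hb' hfc hfD hfΔ hΨc
  obtain ⟨B, hB0, hB⟩ := exists_bound_weight hΨ hΨc
  obtain ⟨Z, hZ0, hZ⟩ := exists_bound_profile hζ a b'
  have hCb : 0 ≤ Cb := (norm_nonneg _).trans (hbB (-1) (by norm_num) 0)
  have hfm := aestronglyMeasurable_slab_of_continuousOn (a := a) hb' hfc
  have happly : Continuous fun q : ((EuclideanSpace ℝ (Fin 3)) →L[ℝ] ℝ) × (EuclideanSpace ℝ (Fin 3)) => q.1 q.2 :=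
    (isBoundedBilinearMap_apply (𝕜 := ℝ) (E := (EuclideanSpace ℝ (Fin 3))) (F := ℝ)).continuous
  have hbm' : Measurable fun p : ℝ × (EuclideanSpace ℝ (Fin 3)) => b p.1 p.2 := hbm
  have hm : AEStronglyMeasurable (fun p : ℝ × (EuclideanSpace ℝ (Fin 3)) => ζ p.1 * ((f p.1 p.2 * f p.1 p.2 - c) * fderiv ℝ Ψ p.2 (b p.1 p.2)))
      ((volume.restrict (Ioc a b')).prod (volume : Measure (EuclideanSpace ℝ (Fin 3)))) :=
    (hζ.continuous.comp continuous_fst).aestronglyMeasurable.mul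
      (((hfm.mul hfm).sub aestronglyMeasurable_const).mul
        (happly.comp_aestronglyMeasurable (((hΨ.continuous_fderiv (by norm_num)).comp
          continuous_snd).aestronglyMeasurable.prodMk hbm'.aestronglyMeasurable)))
  refine integrable_slab_of_bound hΨc hm (C := Z * (K * K + |c|) * (B * Cb)) (by positivity)
    ((ae_slab_mem_and_cylRadius_ne_zero a b').mono fun p hp hy => ?_)
    (fun p hy => by rw [(weight_derivs_eq_zero_of_notMem hy).2.1]; simp)
  have hs : p.1 ∈ Icc a b' := Ioc_subset_Icc_self hp.1
  have hs0 : p.1 < 0 := lt_of_le_of_lt hp.1.2 hb'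
  have hf1 := (hK p.1 hs p.2 hy).1
  have hf2 : |f p.1 p.2 * f p.1 p.2 - c| ≤ K * K + |c| :=
    (abs_sub _ _).trans (add_le_add (by rw [abs_mul]; exact mul_le_mul hf1 hf1 (abs_nonneg _) hK0) le_rfl)
  have hD : |fderiv ℝ Ψ p.2 (b p.1 p.2)| ≤ B * Cb := by
    rw [← Real.norm_eq_abs]
    exact ((fderiv ℝ Ψ p.2).le_opNorm _).trans (mul_le_mul (hB p.2).2.1 (hbB p.1 hs0 p.2) (norm_nonneg _) hB0)
  rw [abs_mul, abs_mul]
  have hri : 0 ≤ (cylRadius p.2)⁻¹ := inv_nonneg.2 (cylRadius_nonneg _)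
  calc |ζ p.1| * (|f p.1 p.2 * f p.1 p.2 - c| * |fderiv ℝ Ψ p.2 (b p.1 p.2)|) ≤ Z * ((K * K + |c|) * (B * Cb)) :=
        mul_le_mul (hZ p.1 hs).1 (mul_le_mul hf2 hD (abs_nonneg _) (by positivity)) (by positivity) hZ0
    _ ≤ Z * (K * K + |c|) * (B * Cb) * ((cylRadius p.2)⁻¹ + 1) := by
        nlinarith [mul_nonneg (by positivity : (0:ℝ) ≤ Z * (K * K + |c|) * (B * Cb)) hri]

/-- Integrability on the slab of the axis integrand `ζ (2/r) f² ∂ᵣΨ`. [folklore] -/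
theorem integrable_slab_axis (hb' : b' < 0)
    (hfc : ContinuousOn (uncurry f) (Iio 0 ×ˢ univ))
    (hfD : ContinuousOn (fun p : ℝ × (EuclideanSpace ℝ (Fin 3)) => fderiv ℝ (f p.1) p.2) (Iio 0 ×ˢ univ))
    (hfΔ : ContinuousOn (fun p : ℝ × (EuclideanSpace ℝ (Fin 3)) => (Δ (f p.1)) p.2) (Iio 0 ×ˢ univ))
    (hΨ : ContDiff ℝ 2 Ψ) (hΨc : HasCompactSupport Ψ) (hζ : ContDiff ℝ 1 ζ) :
    Integrable (fun p : ℝ × (EuclideanSpace ℝ (Fin 3)) => ζ p.1 *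
        (2 / cylRadius p.2 * (f p.1 p.2 * f p.1 p.2 * fderiv ℝ Ψ p.2 (eR p.2))))
      ((volume.restrict (Ioc a b')).prod (volume : Measure (EuclideanSpace ℝ (Fin 3)))) := by
  obtain ⟨K, hK0, hK⟩ := exists_bound_slab hb' hfc hfD hfΔ hΨc
  obtain ⟨B, hB0, hB⟩ := exists_bound_weight hΨ hΨc
  obtain ⟨Z, hZ0, hZ⟩ := exists_bound_profile hζ a b'
  have hfm := aestronglyMeasurable_slab_of_continuousOn (a := a) hb' hfc
  have happly : Continuous fun q : ((EuclideanSpace ℝ (Fin 3)) →L[ℝ] ℝ) × (EuclideanSpace ℝ (Fin 3)) => q.1 q.2 :=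
    (isBoundedBilinearMap_apply (𝕜 := ℝ) (E := (EuclideanSpace ℝ (Fin 3))) (F := ℝ)).continuous
  have heRm : Measurable fun p : ℝ × (EuclideanSpace ℝ (Fin 3)) => eR p.2 := measurable_eR.comp measurable_snd
  have hr2m : AEStronglyMeasurable (fun p : ℝ × (EuclideanSpace ℝ (Fin 3)) => 2 / cylRadius p.2)
      ((volume.restrict (Ioc a b')).prod (volume : Measure (EuclideanSpace ℝ (Fin 3)))) :=
    (measurable_const.div (continuous_cylRadius.measurable.comp measurable_snd)).aestronglyMeasurable
  have hm : AEStronglyMeasurable (fun p : ℝ × (EuclideanSpace ℝ (Fin 3)) => ζ p.1 *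
      (2 / cylRadius p.2 * (f p.1 p.2 * f p.1 p.2 * fderiv ℝ Ψ p.2 (eR p.2))))
      ((volume.restrict (Ioc a b')).prod (volume : Measure (EuclideanSpace ℝ (Fin 3)))) :=
    (hζ.continuous.comp continuous_fst).aestronglyMeasurable.mul (hr2m.mul ((hfm.mul hfm).mul
      (happly.comp_aestronglyMeasurable (((hΨ.continuous_fderiv (by norm_num)).comp
        continuous_snd).aestronglyMeasurable.prodMk heRm.aestronglyMeasurable))))
  refine integrable_slab_of_bound hΨc hm (C := Z * (2 * (K * K) * B)) (by positivity)
    ((ae_slab_mem_and_cylRadius_ne_zero a b').mono fun p hp hy => ?_)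
    (fun p hy => by rw [(weight_derivs_eq_zero_of_notMem hy).2.1]; simp)
  have hs : p.1 ∈ Icc a b' := Ioc_subset_Icc_self hp.1
  have hf1 := (hK p.1 hs p.2 hy).1
  have hf2 : |f p.1 p.2 * f p.1 p.2| ≤ K * K := by rw [abs_mul]; exact mul_le_mul hf1 hf1 (abs_nonneg _) hK0
  have he : |fderiv ℝ Ψ p.2 (eR p.2)| ≤ B := by
    rw [← Real.norm_eq_abs]
    exact ((fderiv ℝ Ψ p.2).le_opNorm _).trans
      ((mul_le_of_le_one_right (norm_nonneg _) (norm_eR_le_one _)).trans (hB p.2).2.1)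
  have hri : 0 ≤ (cylRadius p.2)⁻¹ := inv_nonneg.2 (cylRadius_nonneg _)
  rw [abs_mul, abs_mul, abs_mul, abs_div, abs_two, abs_of_nonneg (cylRadius_nonneg _), div_eq_mul_inv]
  have h1 : |f p.1 p.2 * f p.1 p.2| * |fderiv ℝ Ψ p.2 (eR p.2)| ≤ K * K * B :=
    mul_le_mul hf2 he (abs_nonneg _) (by positivity)
  calc |ζ p.1| * (2 * (cylRadius p.2)⁻¹ * (|f p.1 p.2 * f p.1 p.2| * |fderiv ℝ Ψ p.2 (eR p.2)|))
      ≤ Z * (2 * (cylRadius p.2)⁻¹ * (K * K * B)) :=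
        mul_le_mul (hZ p.1 hs).1 (mul_le_mul_of_nonneg_left h1 (by positivity)) (by positivity) hZ0
    _ ≤ Z * (2 * (K * K) * B) * ((cylRadius p.2)⁻¹ + 1) := by
        nlinarith [mul_nonneg (by positivity : (0:ℝ) ≤ Z * (2 * (K * K) * B)) hri,
          (by positivity : (0:ℝ) ≤ Z * (2 * (K * K) * B))]

/-- Integrability on the slab of the time-derivative integrand `ζ' f² Ψ`. [folklore] -/
theorem integrable_slab_timeDeriv (hb' : b' < 0)
    (hfc : ContinuousOn (uncurry f) (Iio 0 ×ˢ univ))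
    (hfD : ContinuousOn (fun p : ℝ × (EuclideanSpace ℝ (Fin 3)) => fderiv ℝ (f p.1) p.2) (Iio 0 ×ˢ univ))
    (hfΔ : ContinuousOn (fun p : ℝ × (EuclideanSpace ℝ (Fin 3)) => (Δ (f p.1)) p.2) (Iio 0 ×ˢ univ))
    (hΨ : ContDiff ℝ 2 Ψ) (hΨc : HasCompactSupport Ψ) (hζ : ContDiff ℝ 1 ζ) :
    Integrable (fun p : ℝ × (EuclideanSpace ℝ (Fin 3)) => deriv ζ p.1 * (f p.1 p.2 * f p.1 p.2 * Ψ p.2))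
      ((volume.restrict (Ioc a b')).prod (volume : Measure (EuclideanSpace ℝ (Fin 3)))) := by
  obtain ⟨K, hK0, hK⟩ := exists_bound_slab hb' hfc hfD hfΔ hΨc
  obtain ⟨B, hB0, hB⟩ := exists_bound_weight hΨ hΨc
  obtain ⟨Z, hZ0, hZ⟩ := exists_bound_profile hζ a b'
  have hfm := aestronglyMeasurable_slab_of_continuousOn (a := a) hb' hfc
  have hm : AEStronglyMeasurable (fun p : ℝ × (EuclideanSpace ℝ (Fin 3)) => deriv ζ p.1 * (f p.1 p.2 * f p.1 p.2 * Ψ p.2))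
      ((volume.restrict (Ioc a b')).prod (volume : Measure (EuclideanSpace ℝ (Fin 3)))) :=
    ((hζ.continuous_deriv le_rfl).comp continuous_fst).aestronglyMeasurable.mul
      ((hfm.mul hfm).mul (hΨ.continuous.comp continuous_snd).aestronglyMeasurable)
  refine integrable_slab_of_bound hΨc hm (C := Z * (K * K) * B) (by positivity)
    ((ae_slab_mem_and_cylRadius_ne_zero a b').mono fun p hp hy => ?_)
    (fun p hy => by rw [(weight_derivs_eq_zero_of_notMem hy).1]; ring)
  have hs : p.1 ∈ Icc a b' := Ioc_subset_Icc_self hp.1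
  have hf1 := (hK p.1 hs p.2 hy).1
  have hf2 : |f p.1 p.2 * f p.1 p.2| ≤ K * K := by rw [abs_mul]; exact mul_le_mul hf1 hf1 (abs_nonneg _) hK0
  rw [abs_mul, abs_mul]
  have hri : 0 ≤ (cylRadius p.2)⁻¹ := inv_nonneg.2 (cylRadius_nonneg _)
  calc |deriv ζ p.1| * (|f p.1 p.2 * f p.1 p.2| * |Ψ p.2|) ≤ Z * (K * K * B) :=
        mul_le_mul (hZ p.1 hs).2 (mul_le_mul hf2 (hB p.2).1 (abs_nonneg _) (by positivity)) (by positivity) hZ0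
    _ ≤ Z * (K * K) * B * ((cylRadius p.2)⁻¹ + 1) := by nlinarith [mul_nonneg (by positivity : (0:ℝ) ≤ Z * (K * K) * B) hri]

/-- Integrability on the slab of the integrand `g f ζ Ψ` of the time-integrated swirl equation,
`g = Δf − Df[b] − (2/r)∂ᵣf` (`swirlEqnIntegrand`). [folklore] -/
theorem integrable_slab_swirlEqnIntegrand (hb' : b' < 0)
    (hfc : ContinuousOn (uncurry f) (Iio 0 ×ˢ univ))
    (hfD : ContinuousOn (fun p : ℝ × (EuclideanSpace ℝ (Fin 3)) => fderiv ℝ (f p.1) p.2) (Iio 0 ×ˢ univ))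
    (hfΔ : ContinuousOn (fun p : ℝ × (EuclideanSpace ℝ (Fin 3)) => (Δ (f p.1)) p.2) (Iio 0 ×ˢ univ))
    (hbm : Measurable (uncurry b)) (hbB : ∀ t < 0, ∀ x, ‖b t x‖ ≤ Cb)
    (hΨ : ContDiff ℝ 2 Ψ) (hΨc : HasCompactSupport Ψ) (hζ : ContDiff ℝ 1 ζ) :
    Integrable (fun p : ℝ × (EuclideanSpace ℝ (Fin 3)) => swirlEqnIntegrand f b p.1 p.2 * (f p.1 p.2 * (ζ p.1 * Ψ p.2)))
      ((volume.restrict (Ioc a b')).prod (volume : Measure (EuclideanSpace ℝ (Fin 3)))) := by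
  obtain ⟨K, hK0, hK⟩ := exists_bound_slab hb' hfc hfD hfΔ hΨc
  obtain ⟨B, hB0, hB⟩ := exists_bound_weight hΨ hΨc
  obtain ⟨Z, hZ0, hZ⟩ := exists_bound_profile hζ a b'
  have hCb : 0 ≤ Cb := (norm_nonneg _).trans (hbB (-1) (by norm_num) 0)
  have hfm := aestronglyMeasurable_slab_of_continuousOn (a := a) hb' hfc
  have happly : Continuous fun q : ((EuclideanSpace ℝ (Fin 3)) →L[ℝ] ℝ) × (EuclideanSpace ℝ (Fin 3)) => q.1 q.2 :=
    (isBoundedBilinearMap_apply (𝕜 := ℝ) (E := (EuclideanSpace ℝ (Fin 3))) (F := ℝ)).continuous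
  have hbm' : Measurable fun p : ℝ × (EuclideanSpace ℝ (Fin 3)) => b p.1 p.2 := hbm
  have heRm : Measurable fun p : ℝ × (EuclideanSpace ℝ (Fin 3)) => eR p.2 := measurable_eR.comp measurable_snd
  have hr2m : AEStronglyMeasurable (fun p : ℝ × (EuclideanSpace ℝ (Fin 3)) => 2 / cylRadius p.2)
      ((volume.restrict (Ioc a b')).prod (volume : Measure (EuclideanSpace ℝ (Fin 3)))) :=
    (measurable_const.div (continuous_cylRadius.measurable.comp measurable_snd)).aestronglyMeasurable
  have hDfm := aestronglyMeasurable_slab_of_continuousOn (a := a) hb' hfD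
  have hm : AEStronglyMeasurable (fun p : ℝ × (EuclideanSpace ℝ (Fin 3)) => swirlEqnIntegrand f b p.1 p.2 * (f p.1 p.2 * (ζ p.1 * Ψ p.2)))
      ((volume.restrict (Ioc a b')).prod (volume : Measure (EuclideanSpace ℝ (Fin 3)))) := by
    have h1 := aestronglyMeasurable_slab_of_continuousOn (a := a) hb' hfΔ
    have h2 := happly.comp_aestronglyMeasurable (hDfm.prodMk hbm'.aestronglyMeasurable)
    have h3 := happly.comp_aestronglyMeasurable (hDfm.prodMk heRm.aestronglyMeasurable)
    have h : AEStronglyMeasurable (fun p : ℝ × (EuclideanSpace ℝ (Fin 3)) => ((Δ (f p.1)) p.2 - fderiv ℝ (f p.1) p.2 (b p.1 p.2)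
        - 2 / cylRadius p.2 * fderiv ℝ (f p.1) p.2 (eR p.2)) * (f p.1 p.2 * (ζ p.1 * Ψ p.2)))
        ((volume.restrict (Ioc a b')).prod (volume : Measure (EuclideanSpace ℝ (Fin 3)))) :=
      ((h1.sub h2).sub (hr2m.mul h3)).mul (hfm.mul ((hζ.continuous.comp continuous_fst).aestronglyMeasurable.mul
        (hΨ.continuous.comp continuous_snd).aestronglyMeasurable))
    simpa only [swirlEqnIntegrand, partialDeriv_apply] using h
  refine integrable_slab_of_bound hΨc hm (C := (K + K * Cb + 2 * K) * (K * (Z * B))) (by positivity)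
    ((ae_slab_mem_and_cylRadius_ne_zero a b').mono fun p hp hy => ?_)
    (fun p hy => by rw [(weight_derivs_eq_zero_of_notMem hy).1]; ring)
  have hs : p.1 ∈ Icc a b' := Ioc_subset_Icc_self hp.1
  have hs0 : p.1 < 0 := lt_of_le_of_lt hp.1.2 hb'
  obtain ⟨hf1, hDf, hΔf⟩ := hK p.1 hs p.2 hy
  have hri : 0 ≤ (cylRadius p.2)⁻¹ := inv_nonneg.2 (cylRadius_nonneg _)
  have hDfv : ∀ v : (EuclideanSpace ℝ (Fin 3)), |fderiv ℝ (f p.1) p.2 v| ≤ K * ‖v‖ := fun v => by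
    rw [← Real.norm_eq_abs]; exact ((fderiv ℝ (f p.1) p.2).le_opNorm v).trans (mul_le_mul_of_nonneg_right hDf (norm_nonneg _))
  have hG : |swirlEqnIntegrand f b p.1 p.2| ≤ K + K * Cb + 2 * K * (cylRadius p.2)⁻¹ := by
    simp only [swirlEqnIntegrand, partialDeriv_apply]
    refine (abs_sub _ _).trans (add_le_add ((abs_sub _ _).trans (add_le_add hΔf ?_)) ?_)
    · exact (hDfv _).trans (mul_le_mul_of_nonneg_left (hbB p.1 hs0 p.2) hK0)
    · rw [abs_mul, abs_div, abs_two, abs_of_nonneg (cylRadius_nonneg _), div_eq_mul_inv]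
      have := (hDfv (eR p.2)).trans (mul_le_of_le_one_right hK0 (norm_eR_le_one _))
      nlinarith
  have hrest : |f p.1 p.2 * (ζ p.1 * Ψ p.2)| ≤ K * (Z * B) := by
    rw [abs_mul, abs_mul]
    exact mul_le_mul hf1 (mul_le_mul (hZ p.1 hs).1 (hB p.2).1 (abs_nonneg _) hZ0) (by positivity) hK0
  rw [abs_mul]
  calc |swirlEqnIntegrand f b p.1 p.2| * |f p.1 p.2 * (ζ p.1 * Ψ p.2)| ≤
      (K + K * Cb + 2 * K * (cylRadius p.2)⁻¹) * (K * (Z * B)) := mul_le_mul hG hrest (abs_nonneg _) (by positivity)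
    _ ≤ (K + K * Cb + 2 * K) * (K * (Z * B)) * ((cylRadius p.2)⁻¹ + 1) := by
        have Q1 : 0 ≤ (K + K * Cb) * (K * (Z * B)) * (cylRadius p.2)⁻¹ := by positivity
        have Q2 : 0 ≤ (2 * K) * (K * (Z * B)) := by positivity
        nlinarith [Q1, Q2]

/-! ### The weighted energy identity on `ℝ³ × (a, b)`: the identity -/

/-- **The time identity on a line off the axis.** From the time-integrated swirl equation
`f(t, y) − f(s, y) = ∫ₛᵗ g(τ, y) dτ` for `r(y) ≠ 0` (`g = swirlEqnIntegrand f b`), for `a ≤ b' < 0`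
and `ζ ∈ C¹`:
`∫_{(a,b']} g f ζ Ψ(y) ds = ½ (f(b')² ζ(b') − f(a)² ζ(a)) Ψ(y) − ½ ∫_{(a,b']} ζ' f² Ψ(y) ds`
(Lei–Ren–Zhang 2019, §4, the `∂ₜ` terms `T₁₆, T₁₇` of (4.5)). [cite: LeiRenZhang2019, §4 (4.5) (arXiv pp. 10–11)] -/
theorem swirl_energy_line_identity (hab : a ≤ b') (hb' : b' < 0)
    (hfD : ContinuousOn (fun p : ℝ × (EuclideanSpace ℝ (Fin 3)) => fderiv ℝ (f p.1) p.2) (Iio 0 ×ˢ univ))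
    (hfΔ : ContinuousOn (fun p : ℝ × (EuclideanSpace ℝ (Fin 3)) => (Δ (f p.1)) p.2) (Iio 0 ×ˢ univ))
    (hbm : Measurable (uncurry b)) (hbB : ∀ t < 0, ∀ x, ‖b t x‖ ≤ Cb)
    (heq : ∀ x, cylRadius x ≠ 0 → ∀ s t : ℝ, s ≤ t → t < 0 →
      f t x - f s x = ∫ τ in s..t, swirlEqnIntegrand f b τ x)
    (hζ : ContDiff ℝ 1 ζ) {y : (EuclideanSpace ℝ (Fin 3))} (hy : cylRadius y ≠ 0) :
    ∫ s in Ioc a b', swirlEqnIntegrand f b s y * (f s y * (ζ s * Ψ y)) =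
      (1 / 2) * (f b' y * f b' y * ζ b' - f a y * f a y * ζ a) * Ψ y -
        (1 / 2) * ∫ s in Ioc a b', deriv ζ s * (f s y * f s y * Ψ y) := by
  have hτ' : ∀ s ∈ Icc a b', s < 0 := fun s hs => lt_of_le_of_lt hs.2 hb'
  have happly : Continuous fun q : ((EuclideanSpace ℝ (Fin 3)) →L[ℝ] ℝ) × (EuclideanSpace ℝ (Fin 3)) => q.1 q.2 :=
    (isBoundedBilinearMap_apply (𝕜 := ℝ) (E := (EuclideanSpace ℝ (Fin 3))) (F := ℝ)).continuous
  -- the integrand `g(·, y)` is integrable on `[a, b']`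
  have hslab : MapsTo (fun s : ℝ => ((s, y) : ℝ × (EuclideanSpace ℝ (Fin 3)))) (Icc a b') (Iio 0 ×ˢ univ) :=
    fun s hs => ⟨hτ' s hs, mem_univ _⟩
  have hcs : Continuous fun s : ℝ => ((s, y) : ℝ × (EuclideanSpace ℝ (Fin 3))) := by fun_prop
  have hA : ContinuousOn (fun s => (Δ (f s)) y) (Icc a b') := by
    have h := hfΔ.comp hcs.continuousOn hslab
    simpa only [Function.comp_def] using h
  have hBc : ContinuousOn (fun s => fderiv ℝ (f s) y) (Icc a b') := by
    have h := hfD.comp hcs.continuousOn hslab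
    simpa only [Function.comp_def] using h
  have hbym : Measurable fun s => b s y := by
    have h : Measurable fun s : ℝ => ((s, y) : ℝ × (EuclideanSpace ℝ (Fin 3))) := measurable_id.prodMk measurable_const
    exact hbm.comp h
  obtain ⟨KB, hKB⟩ := (isCompact_Icc (a := a) (b := b')).exists_bound_of_continuousOn hBc
  have hGint : IntegrableOn (fun s => swirlEqnIntegrand f b s y) (Icc a b') := by
    have hA' : IntegrableOn (fun s => (Δ (f s)) y) (Icc a b') := hA.integrableOn_compact isCompact_Icc
    have hD' : IntegrableOn (fun s => 2 / cylRadius y * fderiv ℝ (f s) y (eR y)) (Icc a b') :=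
      ((hBc.clm_apply continuousOn_const).integrableOn_compact isCompact_Icc).const_mul _
    have hBV : IntegrableOn (fun s => fderiv ℝ (f s) y (b s y)) (Icc a b') := by
      have hmeas : AEStronglyMeasurable (fun s => fderiv ℝ (f s) y (b s y))
          (volume.restrict (Icc a b')) := by
        have h1 : AEStronglyMeasurable (fun s => fderiv ℝ (f s) y) (volume.restrict (Icc a b')) :=
          hBc.aestronglyMeasurable measurableSet_Icc
        exact happly.comp_aestronglyMeasurable (h1.prodMk hbym.aestronglyMeasurable)
      refine Integrable.mono' (integrableOn_const (C := KB * Cb) (by exact measure_Icc_lt_top.ne)) hmeas ?_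
      rw [ae_restrict_iff' measurableSet_Icc]
      refine Eventually.of_forall fun s hs => ?_
      rw [Real.norm_eq_abs, ← Real.norm_eq_abs]
      exact ((fderiv ℝ (f s) y).le_opNorm _).trans (mul_le_mul (hKB s hs) (hbB s (hτ' s hs) y) (norm_nonneg _)
        ((norm_nonneg _).trans (hKB s hs)))
    have : IntegrableOn (fun s => (Δ (f s)) y - fderiv ℝ (f s) y (b s y) -
        2 / cylRadius y * fderiv ℝ (f s) y (eR y)) (Icc a b') := (hA'.sub hBV).sub hD'
    simpa only [swirlEqnIntegrand, partialDeriv_apply] using this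
  have hg : IntervalIntegrable (fun s => swirlEqnIntegrand f b s y) volume a b' :=
    (intervalIntegrable_iff_integrableOn_Ioc_of_le hab).2 (hGint.mono_set Ioc_subset_Icc_self)
  have hΦ : ∀ s ∈ Icc a b', f s y = f a y + ∫ r in a..s, swirlEqnIntegrand f b r y := by
    intro s hs
    have h := heq y hy a s hs.1 (hτ' s hs)
    linarith
  have key := integral_mul_mul_eq_of_eq_add_integral (Φ := fun s => f s y)
    (g := fun s => swirlEqnIntegrand f b s y) hab hg hΦ hζ
  have e1 : ∫ s in Ioc a b', swirlEqnIntegrand f b s y * (f s y * (ζ s * Ψ y)) =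
      Ψ y * ∫ s in a..b', swirlEqnIntegrand f b s y * (f s y * ζ s) := by
    rw [intervalIntegral.integral_of_le hab, ← integral_const_mul]
    refine integral_congr_ae (Eventually.of_forall fun s => ?_)
    ring
  have e2 : ∫ s in Ioc a b', deriv ζ s * (f s y * f s y * Ψ y) =
      Ψ y * ∫ s in a..b', f s y * f s y * deriv ζ s := by
    rw [intervalIntegral.integral_of_le hab, ← integral_const_mul]
    refine integral_congr_ae (Eventually.of_forall fun s => ?_)
    ring
  rw [e1, e2, key]
  ring

/-- **Fubini through the lines** for the space–time integral of `g f ζ Ψ`: by the time identity on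
almost every line (`swirl_energy_line_identity`),
`∫∫ g f ζ Ψ dμ = ½ ζ(b') ∫ f(b')² Ψ − ½ ζ(a) ∫ f(a)² Ψ − ½ ∫∫ ζ' f² Ψ dμ`. [cite: LeiRenZhang2019, §4 (4.5) (arXiv pp. 10–11)] -/
theorem swirl_energy_integral_eq_time (hab : a ≤ b') (hb' : b' < 0)
    (hf : ∀ t < 0, ContDiff ℝ 2 (f t))
    (hfc : ContinuousOn (uncurry f) (Iio 0 ×ˢ univ))
    (hfD : ContinuousOn (fun p : ℝ × (EuclideanSpace ℝ (Fin 3)) => fderiv ℝ (f p.1) p.2) (Iio 0 ×ˢ univ))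
    (hfΔ : ContinuousOn (fun p : ℝ × (EuclideanSpace ℝ (Fin 3)) => (Δ (f p.1)) p.2) (Iio 0 ×ˢ univ))
    (hbm : Measurable (uncurry b)) (hbB : ∀ t < 0, ∀ x, ‖b t x‖ ≤ Cb)
    (heq : ∀ x, cylRadius x ≠ 0 → ∀ s t : ℝ, s ≤ t → t < 0 →
      f t x - f s x = ∫ τ in s..t, swirlEqnIntegrand f b τ x)
    (hΨ : ContDiff ℝ 2 Ψ) (hΨc : HasCompactSupport Ψ) (hζ : ContDiff ℝ 1 ζ) :
    ∫ p, swirlEqnIntegrand f b p.1 p.2 * (f p.1 p.2 * (ζ p.1 * Ψ p.2))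
        ∂((volume.restrict (Ioc a b')).prod (volume : Measure (EuclideanSpace ℝ (Fin 3)))) =
      (1 / 2) * ζ b' * (∫ y, f b' y * f b' y * Ψ y) - (1 / 2) * ζ a * (∫ y, f a y * f a y * Ψ y)
        - (1 / 2) * ∫ p, deriv ζ p.1 * (f p.1 p.2 * f p.1 p.2 * Ψ p.2)
          ∂((volume.restrict (Ioc a b')).prod (volume : Measure (EuclideanSpace ℝ (Fin 3)))) := by
  have hint6 := integrable_slab_swirlEqnIntegrand (a := a) hb' hfc hfD hfΔ hbm hbB hΨ hΨc hζ
  have hint5 := integrable_slab_timeDeriv (a := a) hb' hfc hfD hfΔ hΨ hΨc hζ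
  rw [integral_prod_symm _ hint6]
  have e2 : ∀ᵐ y ∂(volume : Measure (EuclideanSpace ℝ (Fin 3))),
      ∫ s in Ioc a b', swirlEqnIntegrand f b s y * (f s y * (ζ s * Ψ y)) =
        (1 / 2) * (f b' y * f b' y * ζ b' - f a y * f a y * ζ a) * Ψ y -
          (1 / 2) * ∫ s in Ioc a b', deriv ζ s * (f s y * f s y * Ψ y) := by
    filter_upwards [ae_cylRadius_ne_zero] with y hy
    exact swirl_energy_line_identity hab hb' hfD hfΔ hbm hbB heq hζ hy
  rw [integral_congr_ae e2]
  -- integrability of the two pieces in `y`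
  have ha0 : a < 0 := lt_of_le_of_lt hab hb'
  have hi_end : ∀ t < 0, Integrable fun y => f t y * f t y * Ψ y := fun t ht =>
    ((((hf t ht).continuous).mul (hf t ht).continuous).mul hΨ.continuous).integrable_of_hasCompactSupport
      hΨc.mul_left
  have hi_A : Integrable fun y => (1 / 2) * (f b' y * f b' y * ζ b' - f a y * f a y * ζ a) * Ψ y := by
    have := ((hi_end b' hb').mul_const (ζ b')).sub ((hi_end a ha0).mul_const (ζ a))
    refine (this.const_mul (1 / 2)).congr (Eventually.of_forall fun y => ?_)
    simp only [Pi.sub_apply]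
    ring
  have hi_B : Integrable fun y => (1 / 2) * ∫ s in Ioc a b', deriv ζ s * (f s y * f s y * Ψ y) :=
    hint5.integral_prod_right.const_mul (1 / 2)
  have eA : ∫ y, (1 / 2) * (f b' y * f b' y * ζ b' - f a y * f a y * ζ a) * Ψ y =
      (1 / 2) * (ζ b' * (∫ y, f b' y * f b' y * Ψ y) - ζ a * (∫ y, f a y * f a y * Ψ y)) := by
    have hfun : (fun y => (1 / 2) * (f b' y * f b' y * ζ b' - f a y * f a y * ζ a) * Ψ y) =
        fun y => (1 / 2) * (ζ b' * (f b' y * f b' y * Ψ y)) - (1 / 2) * (ζ a * (f a y * f a y * Ψ y)) := by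
      funext y; ring
    rw [hfun, integral_sub (((hi_end b' hb').const_mul _).const_mul _) (((hi_end a ha0).const_mul _).const_mul _),
      integral_const_mul, integral_const_mul, integral_const_mul, integral_const_mul]
    ring
  have eB : ∫ y, (1 / 2) * ∫ s in Ioc a b', deriv ζ s * (f s y * f s y * Ψ y) =
      (1 / 2) * ∫ p, deriv ζ p.1 * (f p.1 p.2 * f p.1 p.2 * Ψ p.2)
        ∂((volume.restrict (Ioc a b')).prod (volume : Measure (EuclideanSpace ℝ (Fin 3)))) := by
    rw [integral_const_mul, integral_prod_symm _ hint5]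
  rw [integral_sub hi_A hi_B, eA, eB]
  ring

/-- **Fubini through the slices** for the space–time integral of `g f ζ Ψ`: by the slice identity
(`swirl_energy_slice_identity`) at every time,
`∫∫ g f ζ Ψ dμ = −∫∫ ζ |∇f|² Ψ + ½∫∫ ζ (f² − c) ΔΨ + ½∫∫ ζ (f² − c) DΨ[b] + ½∫∫ ζ (2/r) f² ∂ᵣΨ`.
[cite: LeiRenZhang2019, §4 (4.4)–(4.5) (arXiv p. 10)] -/
theorem swirl_energy_integral_eq_space (hb' : b' < 0)
    (hf : ∀ t < 0, ContDiff ℝ 2 (f t))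
    (hfc : ContinuousOn (uncurry f) (Iio 0 ×ˢ univ))
    (hfD : ContinuousOn (fun p : ℝ × (EuclideanSpace ℝ (Fin 3)) => fderiv ℝ (f p.1) p.2) (Iio 0 ×ˢ univ))
    (hfΔ : ContinuousOn (fun p : ℝ × (EuclideanSpace ℝ (Fin 3)) => (Δ (f p.1)) p.2) (Iio 0 ×ˢ univ))
    (hax : ∀ t < 0, IsAxisymmetricScalar (f t))
    (h0 : ∀ t < 0, ∀ x, cylRadius x = 0 → f t x = 0)
    (hbm : Measurable (uncurry b))
    (hb1 : ∀ t < 0, ContDiff ℝ 1 (b t)) (hbdiv : ∀ t < 0, VectorCalculus.IsDivFree (b t))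
    (hbB : ∀ t < 0, ∀ x, ‖b t x‖ ≤ Cb)
    (hΨ : ContDiff ℝ 2 Ψ) (hΨc : HasCompactSupport Ψ) (hΨa : IsAxisymmetricScalar Ψ)
    (hζ : ContDiff ℝ 1 ζ) (c : ℝ) :
    ∫ p, swirlEqnIntegrand f b p.1 p.2 * (f p.1 p.2 * (ζ p.1 * Ψ p.2))
        ∂((volume.restrict (Ioc a b')).prod (volume : Measure (EuclideanSpace ℝ (Fin 3)))) =
      -(∫ p, ζ p.1 * ((∑ i, (fderiv ℝ (f p.1) p.2 ((EuclideanSpace.basisFun (Fin 3) ℝ) i)) ^ 2) * Ψ p.2)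
          ∂((volume.restrict (Ioc a b')).prod (volume : Measure (EuclideanSpace ℝ (Fin 3)))))
      + (1 / 2) * (∫ p, ζ p.1 * ((f p.1 p.2 * f p.1 p.2 - c) * (Δ Ψ) p.2)
          ∂((volume.restrict (Ioc a b')).prod (volume : Measure (EuclideanSpace ℝ (Fin 3)))))
      + (1 / 2) * (∫ p, ζ p.1 * ((f p.1 p.2 * f p.1 p.2 - c) * fderiv ℝ Ψ p.2 (b p.1 p.2))
          ∂((volume.restrict (Ioc a b')).prod (volume : Measure (EuclideanSpace ℝ (Fin 3)))))
      + (1 / 2) * (∫ p, ζ p.1 * (2 / cylRadius p.2 * (f p.1 p.2 * f p.1 p.2 * fderiv ℝ Ψ p.2 (eR p.2)))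
          ∂((volume.restrict (Ioc a b')).prod (volume : Measure (EuclideanSpace ℝ (Fin 3))))) := by
  have hint6 := integrable_slab_swirlEqnIntegrand (a := a) hb' hfc hfD hfΔ hbm hbB hΨ hΨc hζ
  have hint1 := integrable_slab_dissipation (a := a) hb' hfc hfD hfΔ hΨ hΨc hζ
  have hint2 := integrable_slab_laplacian (a := a) hb' hfc hfD hfΔ hΨ hΨc hζ c
  have hint3 := integrable_slab_transport (a := a) hb' hfc hfD hfΔ hbm hbB hΨ hΨc hζ c
  have hint4 := integrable_slab_axis (a := a) hb' hfc hfD hfΔ hΨ hΨc hζ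
  have hτ : ∀ s ∈ Ioc a b', s < 0 := fun s hs => lt_of_le_of_lt hs.2 hb'
  rw [integral_prod _ hint6, integral_prod _ hint1, integral_prod _ hint2, integral_prod _ hint3,
    integral_prod _ hint4]
  have eslice : ∀ s ∈ Ioc a b',
      ∫ y, swirlEqnIntegrand f b (s, y).1 (s, y).2 * (f (s, y).1 (s, y).2 * (ζ (s, y).1 * Ψ (s, y).2)) =
        -(∫ y, ζ s * ((∑ i, (fderiv ℝ (f s) y ((EuclideanSpace.basisFun (Fin 3) ℝ) i)) ^ 2) * Ψ y))
        + (1 / 2) * (∫ y, ζ s * ((f s y * f s y - c) * (Δ Ψ) y))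
        + (1 / 2) * (∫ y, ζ s * ((f s y * f s y - c) * fderiv ℝ Ψ y (b s y)))
        + (1 / 2) * (∫ y, ζ s * (2 / cylRadius y * (f s y * f s y * fderiv ℝ Ψ y (eR y)))) := by
    intro s hs
    have hs0 := hτ s hs
    have h := swirl_energy_slice_identity (hf s hs0) (hax s hs0) (h0 s hs0) (hb1 s hs0) (hbdiv s hs0)
      hΨ hΨc hΨa c
    have e1 : ∫ y, swirlEqnIntegrand f b s y * (f s y * (ζ s * Ψ y)) =
        ζ s * ∫ y, ((Δ (f s)) y - fderiv ℝ (f s) y (b s y) - 2 / cylRadius y * partialDeriv (eR y) (f s) y) *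
          (f s y * Ψ y) := by
      rw [← integral_const_mul]
      refine integral_congr_ae (Eventually.of_forall fun y => ?_)
      simp only [swirlEqnIntegrand]
      ring
    simp only []
    rw [e1, h, integral_const_mul, integral_const_mul, integral_const_mul, integral_const_mul]
    ring
  rw [setIntegral_congr_fun measurableSet_Ioc eslice]
  have i1 := hint1.integral_prod_left
  have i2 := hint2.integral_prod_left
  have i3 := hint3.integral_prod_left
  have i4 := hint4.integral_prod_left
  rw [integral_add, integral_add, integral_add, integral_neg, integral_const_mul, integral_const_mul,
    integral_const_mul]
  · exact i1.neg
  · exact i2.const_mul _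
  · exact i1.neg.add (i2.const_mul _)
  · exact i3.const_mul _
  · exact (i1.neg.add (i2.const_mul _)).add (i3.const_mul _)
  · exact i4.const_mul _

/-- **The weighted energy identity for the swirl equation** (Lei–Ren–Zhang 2019, §4, (4.4) with
the integrations by parts (4.5)–(4.13), Cartesian form on `ℝ³ × (a, b')`, `b' < 0`). Let
`f : (−∞, 0) × ℝ³ → ℝ` have `C²` slices with `f`, `∇f`, `Δf` jointly continuous, be an axisymmetric
scalar vanishing on the axis, and satisfy the swirl equation with a jointly measurable, bounded,
divergence-free `C¹` drift `b` in time-integrated form off the axis,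
`f(t, x) − f(s, x) = ∫ₛᵗ (Δf − Df[b] − (2/r)∂ᵣf)(τ, x) dτ` (KNSS 2009, (5.10); the class delivered by
`KNSS2009_regularity_axisymmetric_swirl`). Then for every axisymmetric weight `Ψ ∈ C²_c(ℝ³)`, every
time profile `ζ ∈ C¹(ℝ)` and every constant `c`, with `μ = dt|_{(a,b']} ⊗ dx` (all five space–time
integrands being `μ`-integrable: `integrable_slab_dissipation`, `…_laplacian`, `…_transport`,
`…_axis`, `…_timeDeriv`),
`∫∫ ζ |∇f|² Ψ dμ = ½ ∫∫ ζ (f² − c) ΔΨ dμ + ½ ∫∫ ζ (f² − c) DΨ[b] dμ + ½ ∫∫ ζ (2/r) f² ∂ᵣΨ dμ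
  + ½ ∫∫ ζ' f² Ψ dμ − ½ ζ(b') ∫ f(b')² Ψ dx + ½ ζ(a) ∫ f(a)² Ψ dx`. [cite: LeiRenZhang2019, §4 (4.4)–(4.13) (arXiv pp. 10–11)] -/
theorem swirl_energy_spaceTime_identity (hab : a ≤ b') (hb' : b' < 0)
    (hf : ∀ t < 0, ContDiff ℝ 2 (f t))
    (hfc : ContinuousOn (uncurry f) (Iio 0 ×ˢ univ))
    (hfD : ContinuousOn (fun p : ℝ × (EuclideanSpace ℝ (Fin 3)) => fderiv ℝ (f p.1) p.2) (Iio 0 ×ˢ univ))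
    (hfΔ : ContinuousOn (fun p : ℝ × (EuclideanSpace ℝ (Fin 3)) => (Δ (f p.1)) p.2) (Iio 0 ×ˢ univ))
    (hax : ∀ t < 0, IsAxisymmetricScalar (f t))
    (h0 : ∀ t < 0, ∀ x, cylRadius x = 0 → f t x = 0)
    (hbm : Measurable (uncurry b))
    (hb1 : ∀ t < 0, ContDiff ℝ 1 (b t)) (hbdiv : ∀ t < 0, VectorCalculus.IsDivFree (b t))
    (hbB : ∀ t < 0, ∀ x, ‖b t x‖ ≤ Cb)
    (heq : ∀ x, cylRadius x ≠ 0 → ∀ s t : ℝ, s ≤ t → t < 0 →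
      f t x - f s x = ∫ τ in s..t, swirlEqnIntegrand f b τ x)
    (hΨ : ContDiff ℝ 2 Ψ) (hΨc : HasCompactSupport Ψ) (hΨa : IsAxisymmetricScalar Ψ)
    (hζ : ContDiff ℝ 1 ζ) (c : ℝ) :
    ∫ p, ζ p.1 * ((∑ i, (fderiv ℝ (f p.1) p.2 ((EuclideanSpace.basisFun (Fin 3) ℝ) i)) ^ 2) * Ψ p.2)
        ∂((volume.restrict (Ioc a b')).prod (volume : Measure (EuclideanSpace ℝ (Fin 3)))) =
      (1 / 2) * (∫ p, ζ p.1 * ((f p.1 p.2 * f p.1 p.2 - c) * (Δ Ψ) p.2)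
        ∂((volume.restrict (Ioc a b')).prod (volume : Measure (EuclideanSpace ℝ (Fin 3)))))
      + (1 / 2) * (∫ p, ζ p.1 * ((f p.1 p.2 * f p.1 p.2 - c) * fderiv ℝ Ψ p.2 (b p.1 p.2))
        ∂((volume.restrict (Ioc a b')).prod (volume : Measure (EuclideanSpace ℝ (Fin 3)))))
      + (1 / 2) * (∫ p, ζ p.1 * (2 / cylRadius p.2 * (f p.1 p.2 * f p.1 p.2 * fderiv ℝ Ψ p.2 (eR p.2)))
        ∂((volume.restrict (Ioc a b')).prod (volume : Measure (EuclideanSpace ℝ (Fin 3)))))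
      + (1 / 2) * (∫ p, deriv ζ p.1 * (f p.1 p.2 * f p.1 p.2 * Ψ p.2)
        ∂((volume.restrict (Ioc a b')).prod (volume : Measure (EuclideanSpace ℝ (Fin 3)))))
      - (1 / 2) * ζ b' * (∫ y, f b' y * f b' y * Ψ y)
      + (1 / 2) * ζ a * (∫ y, f a y * f a y * Ψ y) := by
  have ht := swirl_energy_integral_eq_time hab hb' hf hfc hfD hfΔ hbm hbB heq hΨ hΨc hζ
  have hx := swirl_energy_integral_eq_space (a := a) hb' hf hfc hfD hfΔ hax h0 hbm hb1 hbdiv hbB hΨ hΨc hΨa hζ c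
  linarith

end SpaceTime

end Literature.Analysis.FluidPDE
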